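import Mathlib
import Summits.QuantumFields.YangMills.Theses.SwapTwistDeficit
import Summits.QuantumFields.YangMills.Theorems.LuscherReductionRunningReductionTraceFormula
import Summits.QuantumFields.YangMills.Theorems.FemtoTransferGapLevelsPos

/-!
# `SwapTwistDeficit.TwistDeficitOfWindowTail` — the regime-split glue (LINE g11-A, ym-idea-4)

Closes the glue item of the split `TwistDeficit ⇐ TwistDeficitLaplaceWindow ∧ TwistDeficitPolyTail`
(stmt-QuantumFields-23778): given `A`, take the window's `a` and constants `(k₁, β₁, L₁)`, the tail's
constants `(k₂, β₂, L₂)` at `(a, A)`, and use `k = max k₁ k₂`, `β₀ = max (max β₁ β₂) 1`, `L₀ = max L₁ L₂`;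
case split on `L ≤ β^a`; monotonicity of `β^{-k}` in `k` (for `β ≥ 1`) times `Z(2L) ≥ 0` (trace formula).
Pure logic + `Real.rpow_le_rpow_of_exponent_le`; no summit content.
-/

set_option autoImplicit false

noncomputable section

open Summit.QuantumFields.YangMills.Theorems.FemtoTransferGap

namespace Summit.QuantumFields.YangMills.Theorems.SwapTwistDeficit

open Summit.QuantumFields.YangMills.Theses.SwapTwistDeficit

/-- Window ∧ tail ⇒ `TwistDeficit` (the glue of the g11-A regime split). -/
theorem twistDeficit_of_window_of_tail (hW : TwistDeficitLaplaceWindow) (hP : TwistDeficitPolyTail) :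
    TwistDeficit := by
  intro A hA
  obtain ⟨a, ha, k₁, β₁, L₁, h₁⟩ := hW
  obtain ⟨k₂, β₂, L₂, h₂⟩ := hP a ha A hA
  refine ⟨max k₁ k₂, max (max β₁ β₂) 1, max L₁ L₂, ?_⟩
  intro β hβ L _ hL hLA
  have hβ1 : 1 ≤ β := le_trans (le_max_right _ _) hβ
  have hβ₁ : β₁ ≤ β := le_trans (le_trans (le_max_left _ _) (le_max_left _ _)) hβ
  have hβ₂ : β₂ ≤ β := le_trans (le_trans (le_max_right _ _) (le_max_left _ _)) hβ
  have hL₁ : L₁ ≤ L := le_trans (le_max_left _ _) hL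
  have hL₂ : L₂ ≤ L := le_trans (le_max_right _ _) hL
  have hβ0 : 0 < β := by linarith
  have hL2 : 2 ≤ 2 * L := by have := Nat.one_le_iff_ne_zero.mpr (NeZero.ne L); omega
  have hZ : 0 ≤ TT.physTrace L β (2 * L) :=
    (TT.traceFormula_all L β (2 * L) hβ1 hL2).nonneg fun k => pow_nonneg (levelValue_su2Rep_pos hβ0 k).le _
  have key : ∀ k' : ℝ, k' ≤ max k₁ k₂ →
      β ^ (-k') * TT.physTrace L β (2 * L) ≤ TT.physTrace L β (2 * L) - TT.twistTrace L β (2 * L) →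
      β ^ (-(max k₁ k₂)) * TT.physTrace L β (2 * L) ≤ TT.physTrace L β (2 * L) - TT.twistTrace L β (2 * L) := by
    intro k' hk' h
    refine le_trans ?_ h
    apply mul_le_mul_of_nonneg_right _ hZ
    exact Real.rpow_le_rpow_of_exponent_le hβ1 (by linarith)
  rcases le_total (L : ℝ) (β ^ a) with hLa | hLa
  · exact key k₁ (le_max_left _ _) (h₁ β hβ₁ L hL₁ hLa)
  · exact key k₂ (le_max_right _ _) (h₂ β hβ₂ L hL₂ hLa hLA)

/-- The glue item `TwistDeficitOfWindowTail` (stmt-QuantumFields-23778) holds. -/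
theorem twistDeficitOfWindowTail : TwistDeficitOfWindowTail :=
  fun hW hP => twistDeficit_of_window_of_tail hW hP

end Summit.QuantumFields.YangMills.Theorems.SwapTwistDeficit

end
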